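import Mathlib
import Summits.Ventures.PercRepro.TriangleCapThreeBelowFourTrianglesC

/-!
# PercRepro — THREE BELOW THE DIAGONAL, FOUR TRIANGLES AT `k = 9` (p3, gen 38; part 114)

At `k = 9` there is NO transversal pair: a transversal pair `(x, y)` has `N(x) ⊔ N(y) = V`, so
`k = d(x) + d(y)`, while each of the four triangles contains exactly one of `x, y`, and the triangles through `x`
(resp. `y`) pairwise share only `x` (resp. `y`) — the four sets `T_i ∖ {x, y}` are pairwise disjoint pairs inside
`N(x) ∪ N(y) ∖ {x, y}`, so `k ≥ 2 + 8 = 10` (`ten_le_of_transversal`).  Hence `Σ₀ ≥ 2m − 24 = 6` at `(9, 15)` and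
`3 Σ deficit ≥ 24 · 6 + 18 = 162 = 18 k` — exactly tight: **`four_triangles_stability_three_nine`** (`K₄⁻`-free,
`k = 9`, `m = 15`, four distinct 3-cliques carrying every triangle ⇒ `Σ_v d(v)² + 15 ≤ 135`).  Axioms: standard.
-/

namespace PercRepro

namespace TriangleCap

namespace C047

open Finset

variable {V : Type*} [Fintype V] [DecidableEq V]

/-- **A TRANSVERSAL PAIR NEEDS TEN VERTICES.** -/
theorem ten_le_of_transversal (D : SimpleGraph V) [DecidableRel D.Adj] (hK : K4mFree D)
    (T₁ T₂ T₃ T₄ : Finset V) (h₁ : T₁.card = 3) (h₂ : T₂.card = 3) (h₃ : T₃.card = 3) (h₄ : T₄.card = 3)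
    (hcl₁ : ∀ x ∈ T₁, ∀ y ∈ T₁, x ≠ y → D.Adj x y) (hcl₂ : ∀ x ∈ T₂, ∀ y ∈ T₂, x ≠ y → D.Adj x y)
    (hcl₃ : ∀ x ∈ T₃, ∀ y ∈ T₃, x ≠ y → D.Adj x y) (hcl₄ : ∀ x ∈ T₄, ∀ y ∈ T₄, x ≠ y → D.Adj x y)
    (h12 : (T₁ ∩ T₂).card ≤ 1) (h13 : (T₁ ∩ T₃).card ≤ 1) (h14 : (T₁ ∩ T₄).card ≤ 1)
    (h23 : (T₂ ∩ T₃).card ≤ 1) (h24 : (T₂ ∩ T₄).card ≤ 1) (h34 : (T₃ ∩ T₄).card ≤ 1)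
    {x y : V} (hxy : D.Adj x y) (h0 : codeg D (x, y) = 0) (hd : deficit D (x, y) = 0) :
    10 ≤ Fintype.card V := by
  have hone₁ : ∀ z, z ∉ T₁ → degIn D T₁ z ≤ 1 := fun z hz => degIn_le_one_of_clique D hK h₁ hcl₁ hz
  have hone₂ : ∀ z, z ∉ T₂ → degIn D T₂ z ≤ 1 := fun z hz => degIn_le_one_of_clique D hK h₂ hcl₂ hz
  have hone₃ : ∀ z, z ∉ T₃ → degIn D T₃ z ≤ 1 := fun z hz => degIn_le_one_of_clique D hK h₃ hcl₃ hz
  have hone₄ : ∀ z, z ∉ T₄ → degIn D T₄ z ≤ 1 := fun z hz => degIn_le_one_of_clique D hK h₄ hcl₄ hz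
  have m₁ := mem_of_deficit_zero D h₁ hone₁ hd
  have m₂ := mem_of_deficit_zero D h₂ hone₂ hd
  have m₃ := mem_of_deficit_zero D h₃ hone₃ hd
  have m₄ := mem_of_deficit_zero D h₄ hone₄ hd
  -- each `T_i ∖ {x, y}` has two elements
  have hcard : ∀ (T : Finset V), T.card = 3 → (∀ a ∈ T, ∀ b ∈ T, a ≠ b → D.Adj a b) → (x ∈ T ∨ y ∈ T) →
      (T \ {x, y}).card = 2 := by
    intro T hT hcl hm
    have hint : (T ∩ {x, y}).card = 1 := by
      rw [card_eq_one]
      rcases hm with hm | hm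
      · refine ⟨x, ?_⟩
        ext t
        rw [mem_inter, mem_singleton, mem_insert, mem_singleton]
        constructor
        · rintro ⟨ht, rfl | rfl⟩
          · rfl
          · exact absurd (not_both_mem D hT hcl hxy h0 hm ht) id
        · rintro rfl; exact ⟨hm, Or.inl rfl⟩
      · refine ⟨y, ?_⟩
        ext t
        rw [mem_inter, mem_singleton, mem_insert, mem_singleton]
        constructor
        · rintro ⟨ht, rfl | rfl⟩
          · exact absurd (not_both_mem D hT hcl hxy h0 ht hm) id
          · rfl
        · rintro rfl; exact ⟨hm, Or.inr rfl⟩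
    have := card_sdiff_add_card_inter T {x, y}
    omega
  have c₁ := hcard T₁ h₁ hcl₁ m₁
  have c₂ := hcard T₂ h₂ hcl₂ m₂
  have c₃ := hcard T₃ h₃ hcl₃ m₃
  have c₄ := hcard T₄ h₄ hcl₄ m₄
  -- the four pairs are pairwise disjoint
  have hdisj : ∀ (T T' : Finset V), T.card = 3 → T'.card = 3 → (∀ a ∈ T, ∀ b ∈ T, a ≠ b → D.Adj a b) →
      (∀ a ∈ T', ∀ b ∈ T', a ≠ b → D.Adj a b) → (T ∩ T').card ≤ 1 → (x ∈ T ∨ y ∈ T) → (x ∈ T' ∨ y ∈ T') →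
      Disjoint (T \ {x, y}) (T' \ {x, y}) := by
    intro T T' hT hT' hcl hcl' hint hm hm'
    rw [disjoint_left]
    intro v hv hv'
    rw [mem_sdiff, mem_insert, mem_singleton, not_or] at hv hv'
    exact not_mem_both_of_transversal D hT hT' hcl hcl' hint hxy h0 hm hm' hv.2.1 hv.2.2 hv.1 hv'.1
  have d12 := hdisj T₁ T₂ h₁ h₂ hcl₁ hcl₂ h12 m₁ m₂
  have d13 := hdisj T₁ T₃ h₁ h₃ hcl₁ hcl₃ h13 m₁ m₃
  have d14 := hdisj T₁ T₄ h₁ h₄ hcl₁ hcl₄ h14 m₁ m₄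
  have d23 := hdisj T₂ T₃ h₂ h₃ hcl₂ hcl₃ h23 m₂ m₃
  have d24 := hdisj T₂ T₄ h₂ h₄ hcl₂ hcl₄ h24 m₂ m₄
  have d34 := hdisj T₃ T₄ h₃ h₄ hcl₃ hcl₄ h34 m₃ m₄
  set W := (T₁ \ {x, y}) ∪ (T₂ \ {x, y}) ∪ (T₃ \ {x, y}) ∪ (T₄ \ {x, y}) with hW
  have hW8 : W.card = 8 := by
    rw [hW, card_union_of_disjoint, card_union_of_disjoint, card_union_of_disjoint d12, c₁, c₂, c₃, c₄]
    · exact disjoint_union_left.mpr ⟨d13, d23⟩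
    · exact disjoint_union_left.mpr ⟨disjoint_union_left.mpr ⟨d14, d24⟩, d34⟩
  have hxyW : Disjoint ({x, y} : Finset V) W := by
    rw [disjoint_left]
    intro v hv hvW
    rw [hW, mem_union, mem_union, mem_union, mem_sdiff, mem_sdiff, mem_sdiff, mem_sdiff] at hvW
    rcases hvW with ((h | h) | h) | h <;> exact h.2 hv
  have := card_le_univ (({x, y} : Finset V) ∪ W)
  rw [card_union_of_disjoint hxyW, card_pair hxy.ne, hW8] at this
  exact this

/-- **THREE BELOW THE DIAGONAL, EXACTLY FOUR TRIANGLES AT `(9, 15)`:** `K₄⁻`-free on `9` vertices with `15` edges,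
four distinct 3-cliques carrying every triangle ⇒ `Σ_v d(v)² + 15 ≤ 135`. -/
theorem four_triangles_stability_three_nine (D : SimpleGraph V) [DecidableRel D.Adj] (hK : K4mFree D)
    (hk : Fintype.card V = 9) (hm : D.edgeFinset.card = 15)
    (T₁ T₂ T₃ T₄ : Finset V) (h₁ : T₁.card = 3) (h₂ : T₂.card = 3) (h₃ : T₃.card = 3) (h₄ : T₄.card = 3)
    (hcl₁ : ∀ x ∈ T₁, ∀ y ∈ T₁, x ≠ y → D.Adj x y) (hcl₂ : ∀ x ∈ T₂, ∀ y ∈ T₂, x ≠ y → D.Adj x y)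
    (hcl₃ : ∀ x ∈ T₃, ∀ y ∈ T₃, x ≠ y → D.Adj x y) (hcl₄ : ∀ x ∈ T₄, ∀ y ∈ T₄, x ≠ y → D.Adj x y)
    (hne12 : T₁ ≠ T₂) (hne13 : T₁ ≠ T₃) (hne14 : T₁ ≠ T₄) (hne23 : T₂ ≠ T₃) (hne24 : T₂ ≠ T₄) (hne34 : T₃ ≠ T₄)
    (hT : ∀ x y z, D.Adj x y → D.Adj x z → D.Adj y z →
      (x ∈ T₁ ∧ y ∈ T₁) ∨ (x ∈ T₂ ∧ y ∈ T₂) ∨ (x ∈ T₃ ∧ y ∈ T₃) ∨ (x ∈ T₄ ∧ y ∈ T₄)) :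
    ∑ v, deg D v * deg D v + 3 * (Fintype.card V - 4) ≤ D.edgeFinset.card * Fintype.card V := by
  have h12 := inter_card_le_one_of_ne D hK h₁ h₂ hcl₁ hcl₂ hne12
  have h13 := inter_card_le_one_of_ne D hK h₁ h₃ hcl₁ hcl₃ hne13
  have h14 := inter_card_le_one_of_ne D hK h₁ h₄ hcl₁ hcl₄ hne14
  have h23 := inter_card_le_one_of_ne D hK h₂ h₃ hcl₂ hcl₃ hne23
  have h24 := inter_card_le_one_of_ne D hK h₂ h₄ hcl₂ hcl₄ hne24
  have h34 := inter_card_le_one_of_ne D hK h₃ h₄ hcl₃ hcl₄ hne34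
  -- no transversal pair
  have hTr : ((adjPairsAll D).filter (fun p => codeg D p = 0 ∧ deficit D p = 0)).card = 0 := by
    rw [card_eq_zero, filter_eq_empty_iff]
    intro p hp ⟨h0, hd⟩
    rw [mem_adjPairsAll] at hp
    have := ten_le_of_transversal D hK T₁ T₂ T₃ T₄ h₁ h₂ h₃ h₄ hcl₁ hcl₂ hcl₃ hcl₄ h12 h13 h14 h23 h24 h34 hp h0 hd
    omega
  -- `|T₃| = 24`
  have hF : ({T₁, T₂, T₃, T₄} : Finset (Finset V)).card = 4 := by
    rw [card_insert_of_notMem, card_insert_of_notMem, card_insert_of_notMem, card_singleton]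
    · rw [mem_singleton]; exact hne34
    · rw [mem_insert, mem_singleton, not_or]; exact ⟨hne23, hne24⟩
    · rw [mem_insert, mem_insert, mem_singleton, not_or, not_or]; exact ⟨hne12, hne13, hne14⟩
  have h24T := six_mul_card_le_card_triangles3 D {T₁, T₂, T₃, T₄} (by
    intro T hT'
    simp only [mem_insert, mem_singleton] at hT'
    rcases hT' with rfl | rfl | rfl | rfl
    · exact exists_triple_of_clique D h₁ hcl₁
    · exact exists_triple_of_clique D h₂ hcl₂
    · exact exists_triple_of_clique D h₃ hcl₃
    · exact exists_triple_of_clique D h₄ hcl₄)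
  rw [hF] at h24T
  have h24' := card_triangles3_le_twentyfour_of_four D T₁ T₂ T₃ T₄ h₁ h₂ h₃ h₄ hcl₁ hcl₂ hcl₃ hcl₄ hT
    (fun x y z z' hxy hxz hyz hxz' hyz' => eq_of_common_nbr D hK hxy hxz hyz hxz' hyz')
  have hT3 : (triangles3 D).card = 24 := by omega
  have hsplit := sum_deficit_split D hK
  have hout := card_mul_add_two_mul_sum_outer_le D hK
  have hc0 := card_codeg_zero_add_card_triangles3 D hK
  have hle := card_codeg_zero_le_sum_deficit_add D
  have hid := two_mul_sum_deg_sq_add_sum_deficit D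
  rw [hT3] at hout hc0 hid
  rw [hTr] at hle
  rw [hk] at hout hid ⊢
  rw [hm] at hid hc0 ⊢
  omega

end C047

end TriangleCap

end PercRepro
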